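import Summits.QuantumFields.YangMills.Theorems.PoincareLipschitzMedianCentringLinearStep
import HarnessLib

/-!
# Crux `HistoryTailL` (stmt-QuantumFields-19936) — FILE K-17a: LINE 27's ONE-HEIGHT STEP WITH THE «UV GUARD» ON THE CONCENTRATION HYPOTHESIS
# (companion of the K2-lane face v14 `PoincareLipschitzHistoryTailOfUVBoxConcentration`; LEAD seat ym-ust-19936-w1 g11)

Cell `ym3-torus` (YM ladder rung R3 = continuum SU(2) Yang–Mills on T³ — a RUNG, NOT the Clay problem: not d = 4, not infinite volume, not a
mass gap).  Helper `--supports stmt-QuantumFields-19936`; THEOREMS ONLY, def-free.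

WHAT.  ✓`PoincareLipschitz.MedianCentring.local_step_lin_median` (T-5, ym3-torus-px10 g6) takes the K1-exp concentration hypothesis for EVERY box
side `1 ≤ n ≤ β_K` but applies it at exactly one side, `n = 17·L^j` with `j + 2 ≤ K` (its ll. 273 ∕ 298).  `local_step_lin_median_uv` below is
that step VERBATIM with the hypothesis `hK1` carrying ONE extra binder `n ≤ 17·L^(K−2)` — discharged at the two application sites by
`17·L^j ≤ 17·L^(K−2)`.  So the step, and with it the whole K2 lane, only ever reads concentration on boxes of physical side ≤ `17·L⁻²` unit
lengths (running coupling `≤ 17γ∕L²`), never on the registered range up to `n = β_K` (physical side `1∕γ`, the crossover scale).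
NOTHING of K1-exp, K2, (Q) is proved here; `HistoryTailL` is NOT proved; YM₃ on T³ is rung R3, not Clay; the Yang–Mills mass gap is NOT proved.

[adapted verbatim from ✓`PoincareLipschitzMedianCentringLinearStep.local_step_lin_median` (ym3-torus-px10 g6), itself from
✓`PoincareLipschitzLinearStep.local_step_lin` (ym-ust-19936-w4 g12) and ✓`…MedianCentringLocalStep.local_step_median`; credits there.]
References: T. Bałaban, CMP 102 (1985) 255–275 [Balaban1985UV3]; M. Ledoux, The concentration of measure phenomenon, AMS (2001) [Ledoux2001].
-/

set_option autoImplicit false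

namespace Summit.QuantumFields.YangMills.Theorems.PoincareLipschitzMedianCentringLinearStepUV

open MeasureTheory
open scoped BigOperators
open Literature.MathematicalPhysics.QuantumFieldTheory.Balaban1983to89
open Literature.MathematicalPhysics.QuantumFieldTheory.Balaban1983to89.T3ContinuumYM3Torus
open Literature.MathematicalPhysics.QuantumFieldTheory.Balaban1983to89.T3UnitScaleTilt
open Literature.MathematicalPhysics.QuantumFieldTheory.Balaban1983to89.T3UnitLawDensityEML (ℰp measurableE_ℰp)
open Literature.MathematicalPhysics.QuantumFieldTheory.Balaban1983to89.T3OrbitAverage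
open Literature.MathematicalPhysics.QuantumFieldTheory.Balaban1983to89.T3MinimiserStabilityReduction (θBal_pos)
open Literature.MathematicalPhysics.QuantumFieldTheory.Balaban1983to89.T3FinestHeightTail (beta_mul_θBal_sq)
open Literature.MathematicalPhysics.QuantumFieldTheory.Balaban1983to89.T4PairDerivBridge (dist1_le_two_specialUnitaryGroup)
open Summit.QuantumFields.YangMills.Theorems.PoincareLipschitz.TwoSidedOfConcentration
open Summit.QuantumFields.YangMills.Theorems.PoincareLipschitz.MedianCentring (centring_radius_le_lin exponent_le_log_of_half_le)

-- hb: as in the source T-5 — the decl elaborates between 100k and 150k heartbeats; the decl-local 400000 is README-class headroom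
-- against the CI heartbeat cliff (HOME/README.md RULES «HEARTBEAT BUDGET»), not a content need.
set_option maxHeartbeats 400000 in
/-- **THE ONE-HEIGHT STEP CENTRED AT THE MEDIAN, p-LINEAR, WITH THE UV GUARD.**  Verbatim ✓`PoincareLipschitz.MedianCentring.local_step_lin_median`
(capped McShane extension `g` of the block plaquette deviation on the local good set, median centring by K1-exp for `−g`, K1-exp for `g` at
`r = θ∕4`), the concentration hypothesis `hK1` now carrying the extra binder `n ≤ 17·L^(K−2)`; it is applied only at `n = 17·L^j`, where the guard
holds by `j + 2 ≤ K`.  [cite: Balaban1985UV3, (3) p.256 and (7) p.257; Ledoux2001, Prop. 1.3] -/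
theorem local_step_lin_median_uv (F : T3Family) {γ b₀ p₀ : ℝ} (hγ : 0 < γ) (hγ2 : γ ≤ 1 / 2) (hb₀ : 0 < b₀)
    {K j : ℕ} (hjK : j + 2 ≤ K) (a : Plaq (F.P K) j) {Cc cc CL : ℝ} (hCL : 0 ≤ CL)
    (hK1 : ∀ (n : ℕ), 1 ≤ n → n ≤ 17 * F.L ^ (K - 2) → (n : ℝ) ≤ (F.scheme ℰp γ).β K → 2 * n ≤ (F.P K).sitesPerDir 0 →
      ∀ (x₀ : Site (F.P K) 0) (f : GaugeField (F.P K) 0 (Matrix.specialUnitaryGroup (Fin 2) ℂ) → ℝ) (Λ : ℝ), 0 < Λ → Measurable f → GaugeField.GaugeInvariant f →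
      (∀ U U' : GaugeField (F.P K) 0 (Matrix.specialUnitaryGroup (Fin 2) ℂ), (∀ b : PBond (F.P K) 0, (∀ k, (b.src k - x₀ k).val < n) → (∀ k, (b.tgt k - x₀ k).val < n) → U b = U' b) →
        f U = f U') →
      (∀ U U' : GaugeField (F.P K) 0 (Matrix.specialUnitaryGroup (Fin 2) ℂ), |f U - f U'| ≤ Λ * Real.sqrt (∑ b : PBond (F.P K) 0, GaugeGroup.dist1 (U b * (U' b)⁻¹) ^ 2)) →
      ∀ r : ℝ, 0 ≤ r → (gibbsK F ℰp γ K).real {U | r ≤ f U - ∫ V, f V ∂(gibbsK F ℰp γ K)} ≤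
        Cc * Real.exp (-(cc * Real.sqrt ((F.scheme ℰp γ).β K) * r / ((n : ℝ) * Λ))))
    (hK2 : ∀ U U' : GaugeField (F.P K) 0 (Matrix.specialUnitaryGroup (Fin 2) ℂ), (∀ (i : ℕ) (q : Plaq (F.P K) i), i < j → Site.tdist (fun k => ((((q.src k).val * F.L ^ i : ℕ)) : ZMod ((F.P K).sitesPerDir 0))) (fun k => ((((a.src k).val * F.L ^ j : ℕ)) : ZMod ((F.P K).sitesPerDir 0))) + 64 * F.L ^ i ≤ 64 * F.L ^ j → GaugeGroup.dist1 (GaugeField.plaqHol (Averaging.iter (fun i' => BlockAveraging.blockAvg (P := F.P K) (j := i') ℰp) i U) q) < θBal F.L γ b₀ p₀ (K - i)) → (∀ (i : ℕ) (q : Plaq (F.P K) i), i < j → Site.tdist (fun k => ((((q.src k).val * F.L ^ i : ℕ)) : ZMod ((F.P K).sitesPerDir 0))) (fun k => ((((a.src k).val * F.L ^ j : ℕ)) : ZMod ((F.P K).sitesPerDir 0))) + 64 * F.L ^ i ≤ 64 * F.L ^ j → GaugeGroup.dist1 (GaugeField.plaqHol (Averaging.iter (fun i' => BlockAveraging.blockAvg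 (P := F.P K) (j := i') ℰp) i U') q) < θBal F.L γ b₀ p₀ (K - i)) →
      |GaugeGroup.dist1 (GaugeField.plaqHol (Averaging.iter (fun i' => BlockAveraging.blockAvg (P := F.P K) (j := i') ℰp) j U) a) - GaugeGroup.dist1 (GaugeField.plaqHol (Averaging.iter (fun i' => BlockAveraging.blockAvg (P := F.P K) (j := i') ℰp) j U') a)| ≤ CL / Real.sqrt ((F.L : ℝ) ^ j) * Real.sqrt (∑ b : PBond (F.P K) 0, if (∀ k, (b.src k - ((((a.src k).val * F.L ^ j : ℕ)) : ZMod ((F.P K).sitesPerDir 0)) + ((8 * F.L ^ j : ℕ) : ZMod ((F.P K).sitesPerDir 0))).val < 17 * F.L ^ j) ∧ (∀ k, (b.tgt k - ((((a.src k).val * F.L ^ j : ℕ)) : ZMod ((F.P K).sitesPerDir 0)) + ((8 * F.L ^ j : ℕ) : ZMod ((F.P K).sitesPerDir 0))).val < 17 * F.L ^ j) then GaugeGroup.dist1 (U b * (U' b)⁻¹) ^ 2 else 0))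
    (hcc : 0 < cc)
    (hp : 136 * (CL + 1) * (Real.log (2 * Cc + 2) / cc) ≤ B10.pFun b₀ p₀ (Real.sqrt (γ * ((F.L : ℝ)⁻¹) ^ (K - j))))
    (hMed : 3 / 4 ≤ (gibbsK F ℰp γ K).real {U : GaugeField (F.P K) 0 (Matrix.specialUnitaryGroup (Fin 2) ℂ) | GaugeGroup.dist1 (GaugeField.plaqHol (Averaging.iter (fun i' => BlockAveraging.blockAvg (P := F.P K) (j := i') ℰp) j U) a) ≤ θBal F.L γ b₀ p₀ (K - j) / 8})
    (hGc : (gibbsK F ℰp γ K).real {U : GaugeField (F.P K) 0 (Matrix.specialUnitaryGroup (Fin 2) ℂ) | (∀ (i : ℕ) (q : Plaq (F.P K) i), i < j → Site.tdist (fun k => ((((q.src k).val * F.L ^ i : ℕ)) : ZMod ((F.P K).sitesPerDir 0))) (fun k => ((((a.src k).val * F.L ^ j : ℕ)) : ZMod ((F.P K).sitesPerDir 0))) + 64 * F.L ^ i ≤ 64 * F.L ^ j → GaugeGroup.dist1 (GaugeField.plaqHol (Averaging.iter (fun i' => BlockAveraging.blockAvg (P := F.P K) (j := i') ℰp) i U)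 q) < θBal F.L γ b₀ p₀ (K - i))}ᶜ ≤ 1 / 4) :
    (gibbsK F ℰp γ K).real ({U : GaugeField (F.P K) 0 (Matrix.specialUnitaryGroup (Fin 2) ℂ) | θBal F.L γ b₀ p₀ (K - j) ≤ GaugeGroup.dist1 (GaugeField.plaqHol (Averaging.iter (fun i' => BlockAveraging.blockAvg (P := F.P K) (j := i') ℰp) j U) a)} ∩ {U : GaugeField (F.P K) 0 (Matrix.specialUnitaryGroup (Fin 2) ℂ) | (∀ (i : ℕ) (q : Plaq (F.P K) i), i < j → Site.tdist (fun k => ((((q.src k).val * F.L ^ i : ℕ)) : ZMod ((F.P K).sitesPerDir 0))) (fun k => ((((a.src k).val * F.L ^ j : ℕ)) : ZMod ((F.P K).sitesPerDir 0))) + 64 * F.L ^ i ≤ 64 * F.L ^ j → GaugeGroup.dist1 (GaugeField.plaqHol (Averaging.iter (fun i' => BlockAveraging.blockAvg (P := F.P K) (j := i') ℰp) i U) q) < θBal F.L γ b₀ p₀ (K - i))}) ≤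
      Cc * Real.exp (-(cc / (68 * (CL + 1)) * B10.pFun b₀ p₀ (Real.sqrt (γ * ((F.L : ℝ)⁻¹) ^ (K - j))))) := by
  haveI := isProbabilityMeasure_gibbsK F ℰp hγ.le K
  have hγ1 : γ ≤ 1 := by linarith
  have hL1 : 1 ≤ F.L := F.hL.2.le
  have hL3 : 3 ≤ F.L := by obtain ⟨k, hk⟩ := F.hL.1; have := F.hL.2; omega
  have hLr : (3 : ℝ) ≤ F.L := by exact_mod_cast hL3
  set μ := gibbsK F ℰp γ K with hμ
  set θ := θBal F.L γ b₀ p₀ (K - j) with hθ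
  have hθpos : 0 < θ := θBal_pos hL1 hγ hγ1 hb₀ p₀ (K - j)
  have hLj : (0 : ℝ) < (F.L : ℝ) ^ j := by positivity
  have hsq : 0 < Real.sqrt ((F.L : ℝ) ^ j) := Real.sqrt_pos.mpr hLj
  set Λ : ℝ := (CL + 1) / Real.sqrt ((F.L : ℝ) ^ j) with hΛ
  have hΛpos : 0 < Λ := div_pos (by linarith) hsq
  set f : GaugeField (F.P K) 0 (Matrix.specialUnitaryGroup (Fin 2) ℂ) → ℝ := fun U => GaugeGroup.dist1 (GaugeField.plaqHol (Averaging.iter (fun i' => BlockAveraging.blockAvg (P := F.P K) (j := i') ℰp) j U) a) with hf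
  set G : Set (GaugeField (F.P K) 0 (Matrix.specialUnitaryGroup (Fin 2) ℂ)) := {U : GaugeField (F.P K) 0 (Matrix.specialUnitaryGroup (Fin 2) ℂ) | (∀ (i : ℕ) (q : Plaq (F.P K) i), i < j → Site.tdist (fun k => ((((q.src k).val * F.L ^ i : ℕ)) : ZMod ((F.P K).sitesPerDir 0))) (fun k => ((((a.src k).val * F.L ^ j : ℕ)) : ZMod ((F.P K).sitesPerDir 0))) + 64 * F.L ^ i ≤ 64 * F.L ^ j → GaugeGroup.dist1 (GaugeField.plaqHol (Averaging.iter (fun i' => BlockAveraging.blockAvg (P := F.P K) (j := i') ℰp) i U) q) < θBal F.L γ b₀ p₀ (K - i))} with hG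
  set d : GaugeField (F.P K) 0 (Matrix.specialUnitaryGroup (Fin 2) ℂ) → GaugeField (F.P K) 0 (Matrix.specialUnitaryGroup (Fin 2) ℂ) → ℝ := fun U U' => Real.sqrt (∑ b : PBond (F.P K) 0, if (∀ k, (b.src k - ((((a.src k).val * F.L ^ j : ℕ)) : ZMod ((F.P K).sitesPerDir 0)) + ((8 * F.L ^ j : ℕ) : ZMod ((F.P K).sitesPerDir 0))).val < 17 * F.L ^ j) ∧ (∀ k, (b.tgt k - ((((a.src k).val * F.L ^ j : ℕ)) : ZMod ((F.P K).sitesPerDir 0)) + ((8 * F.L ^ j : ℕ) : ZMod ((F.P K).sitesPerDir 0))).val < 17 * F.L ^ j) then GaugeGroup.dist1 (U b * (U' b)⁻¹) ^ 2 else 0) with hd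
  -- §1 the McShane extension
  obtain ⟨g, hg0, hgθ, hgf, hgeq, hgLip, hginv, hgloc, hgmeas⟩ :=
    exists_capped_infConvolution d (fun U U' => boxLinkDist_nonneg _ U U') (fun U => boxLinkDist_self _ U)
      (fun U U' => boxLinkDist_comm _ U U') (fun U U' U'' => boxLinkDist_triangle _ U U' U'')
      (fun U' => continuous_boxLinkDist _ U') G f (fun U => GaugeGroup.dist1_nonneg _) θ Λ hθpos.le hΛpos.le
      (fun U hU U' hU' => (hK2 U U' hU hU').trans
        (mul_le_mul_of_nonneg_right (div_le_div_of_nonneg_right (by linarith) hsq.le) (Real.sqrt_nonneg _)))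
      (GaugeField.gaugeAct (P := F.P K) (j := 0) (G := (Matrix.specialUnitaryGroup (Fin 2) ℂ)))
      (fun u U hU => by
        simp only [hG, Set.mem_setOf_eq] at hU ⊢
        intro i q hi hnear
        rw [dist1_plaqHol_iter_gaugeAct F (by omega) q u U]
        exact hU i q hi hnear)
      (fun u U => by simp only [hf]; exact dist1_plaqHol_iter_gaugeAct F (by omega) a u U)
      (fun u U U' => boxLinkDist_gaugeAct _ u U U')
      (fun u => ⟨fun x => (u x)⁻¹, gaugeAct_gaugeAct_inv u⟩)
      (fun U U' => ∀ b : PBond (F.P K) 0, (∀ k, (b.src k - ((((a.src k).val * F.L ^ j : ℕ)) : ZMod ((F.P K).sitesPerDir 0)) + ((8 * F.L ^ j : ℕ) : ZMod ((F.P K).sitesPerDir 0))).val < 17 * F.L ^ j) ∧ (∀ k, (b.tgt k - ((((a.src k).val * F.L ^ j : ℕ)) : ZMod ((F.P K).sitesPerDir 0)) + ((8 * F.L ^ j : ℕ) : ZMod ((F.P K).sitesPerDir 0))).val < 17 * F.L ^ j) → U b = U' b)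
      (fun U U' h V => boxLinkDist_congr_left _ h V)
  -- §2 measurability and integrability
  have hmeas : ∀ (i : ℕ) (q : Plaq (F.P K) i), Measurable fun U : GaugeField (F.P K) 0 (Matrix.specialUnitaryGroup (Fin 2) ℂ) =>
      GaugeGroup.dist1 (GaugeField.plaqHol (Averaging.iter (fun i' => BlockAveraging.blockAvg (P := F.P K) (j := i') ℰp) i U) q) :=
    fun i q => RegularGaugeGroup.measurable_dist1.comp ((Missing.measurable_plaqHol q).comp
      (T4Continuum.measurable_iter _ (F.avgMeasurable_of_measurableE ℰp measurableE_ℰp K) i))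
  have hf_meas : Measurable f := hmeas j a
  have hf_int : Integrable f μ :=
    Integrable.mono' (integrable_const (2 : ℝ)) hf_meas.aestronglyMeasurable
      (ae_of_all _ fun U => by
        rw [Real.norm_eq_abs, abs_of_nonneg (GaugeGroup.dist1_nonneg _)]
        exact dist1_le_two_specialUnitaryGroup _)
  have hg_int : Integrable g μ :=
    Integrable.mono' (integrable_const θ) hgmeas.aestronglyMeasurable
      (ae_of_all _ fun U => by rw [Real.norm_eq_abs, abs_of_nonneg (hg0 U)]; exact hgθ U)
  have hG_meas : MeasurableSet G := by
    have hGeq : G = ⋂ (i : ℕ), ⋂ (q : Plaq (F.P K) i),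
        {U : GaugeField (F.P K) 0 (Matrix.specialUnitaryGroup (Fin 2) ℂ) | i < j → Site.tdist (fun k => ((((q.src k).val * F.L ^ i : ℕ)) : ZMod ((F.P K).sitesPerDir 0))) (fun k => ((((a.src k).val * F.L ^ j : ℕ)) : ZMod ((F.P K).sitesPerDir 0))) + 64 * F.L ^ i ≤ 64 * F.L ^ j → GaugeGroup.dist1 (GaugeField.plaqHol (Averaging.iter (fun i' => BlockAveraging.blockAvg (P := F.P K) (j := i') ℰp) i U) q) < θBal F.L γ b₀ p₀ (K - i)} := by
      ext U
      simp only [hG, Set.mem_setOf_eq, Set.mem_iInter]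
    rw [hGeq]
    refine MeasurableSet.iInter fun i => MeasurableSet.iInter fun q => ?_
    by_cases hc : i < j ∧ Site.tdist (fun k => ((((q.src k).val * F.L ^ i : ℕ)) : ZMod ((F.P K).sitesPerDir 0))) (fun k => ((((a.src k).val * F.L ^ j : ℕ)) : ZMod ((F.P K).sitesPerDir 0))) + 64 * F.L ^ i ≤ 64 * F.L ^ j
    · have hset : {U : GaugeField (F.P K) 0 (Matrix.specialUnitaryGroup (Fin 2) ℂ) | i < j → Site.tdist (fun k => ((((q.src k).val * F.L ^ i : ℕ)) : ZMod ((F.P K).sitesPerDir 0))) (fun k => ((((a.src k).val * F.L ^ j : ℕ)) : ZMod ((F.P K).sitesPerDir 0))) + 64 * F.L ^ i ≤ 64 * F.L ^ j → GaugeGroup.dist1 (GaugeField.plaqHol (Averaging.iter (fun i' => BlockAveraging.blockAvg (P := F.P K) (j := i') ℰp) i U) q) < θBal F.L γ b₀ p₀ (K - i)} =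
          {U : GaugeField (F.P K) 0 (Matrix.specialUnitaryGroup (Fin 2) ℂ) | GaugeGroup.dist1 (GaugeField.plaqHol (Averaging.iter (fun i' => BlockAveraging.blockAvg (P := F.P K) (j := i') ℰp) i U) q) < θBal F.L γ b₀ p₀ (K - i)} := by
        ext U
        simp only [Set.mem_setOf_eq]
        exact ⟨fun h => h hc.1 hc.2, fun h _ _ => h⟩
      rw [hset]
      exact measurableSet_lt (hmeas i q) measurable_const
    · have hset : {U : GaugeField (F.P K) 0 (Matrix.specialUnitaryGroup (Fin 2) ℂ) | i < j → Site.tdist (fun k => ((((q.src k).val * F.L ^ i : ℕ)) : ZMod ((F.P K).sitesPerDir 0))) (fun k => ((((a.src k).val * F.L ^ j : ℕ)) : ZMod ((F.P K).sitesPerDir 0))) + 64 * F.L ^ i ≤ 64 * F.L ^ j → GaugeGroup.dist1 (GaugeField.plaqHol (Averaging.iter (fun i' => BlockAveraging.blockAvg (P := F.P K) (j := i') ℰp) i U) q) < θBal F.L γ b₀ p₀ (K - i)} = Set.univ := by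
        ext U
        simp only [Set.mem_setOf_eq, Set.mem_univ, iff_true]
        intro h1 h2
        exact absurd ⟨h1, h2⟩ hc
      rw [hset]
      exact MeasurableSet.univ
  -- §3 the box: side `n = 17 L^j`, corner `corner(a) L^j − 8 L^j`
  have h1n : 1 ≤ 17 * F.L ^ j := by
    have : 1 ≤ F.L ^ j := Nat.one_le_pow _ _ (by omega)
    omega
  -- (UV GUARD) the only box side ever used is `17·L^j ≤ 17·L^(K−2)`
  have hnK : 17 * F.L ^ j ≤ 17 * F.L ^ (K - 2) :=
    Nat.mul_le_mul_left _ (Nat.pow_le_pow_right (by omega) (by omega))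
  have h2n : 2 * (17 * F.L ^ j) ≤ (F.P K).sitesPerDir 0 := by
    have hN0 : (F.P K).sitesPerDir 0 = 2 * F.L ^ (F.m + K) := by simp [Params.sitesPerDir]
    rw [hN0]
    have hsplit : F.L ^ (F.m + K) = F.L ^ j * F.L ^ (F.m + K - j) := by rw [← pow_add]; congr 1; omega
    have h27 : 27 ≤ F.L ^ (F.m + K - j) :=
      calc 27 = 3 ^ 3 := by norm_num
        _ ≤ F.L ^ 3 := Nat.pow_le_pow_left hL3 3
        _ ≤ F.L ^ (F.m + K - j) := Nat.pow_le_pow_right (by omega) (by have := F.hm; omega)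
    rw [hsplit]
    nlinarith
  have hβK : (F.scheme ℰp γ).β K = (F.L : ℝ) ^ K / γ := by
    show (γ * (F.P K).eps)⁻¹ = _
    have heps : (F.P K).eps = ((F.L : ℝ)⁻¹) ^ K := rfl
    rw [heps, mul_inv, inv_pow, inv_inv, div_eq_inv_mul]
  have hnβ : ((17 * F.L ^ j : ℕ) : ℝ) ≤ (F.scheme ℰp γ).β K := by
    rw [hβK, le_div_iff₀ hγ]
    push_cast
    have hsplit : (F.L : ℝ) ^ K = (F.L : ℝ) ^ j * (F.L : ℝ) ^ (K - j) := by rw [← pow_add]; congr 1; omega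
    have h9 : (9 : ℝ) ≤ (F.L : ℝ) ^ (K - j) :=
      calc (9 : ℝ) = 3 ^ 2 := by norm_num
        _ ≤ (F.L : ℝ) ^ 2 := pow_le_pow_left₀ (by norm_num) hLr 2
        _ ≤ (F.L : ℝ) ^ (K - j) := pow_le_pow_right₀ (by linarith) (by omega)
    rw [hsplit]
    nlinarith
  set x₀ : Site (F.P K) 0 := fun k => ((((a.src k).val * F.L ^ j : ℕ)) : ZMod ((F.P K).sitesPerDir 0)) - ((8 * F.L ^ j : ℕ) : ZMod ((F.P K).sitesPerDir 0)) with hx₀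
  have hbox : ∀ U U' : GaugeField (F.P K) 0 (Matrix.specialUnitaryGroup (Fin 2) ℂ), (∀ b : PBond (F.P K) 0, (∀ k, (b.src k - x₀ k).val < 17 * F.L ^ j) →
      (∀ k, (b.tgt k - x₀ k).val < 17 * F.L ^ j) → U b = U' b) → g U = g U' := by
    intro U U' h
    refine hgloc U U' fun b hb => h b (fun k => ?_) (fun k => ?_)
    · have hk : b.src k - x₀ k = b.src k - ((((a.src k).val * F.L ^ j : ℕ)) : ZMod ((F.P K).sitesPerDir 0)) + ((8 * F.L ^ j : ℕ) : ZMod ((F.P K).sitesPerDir 0)) := by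
        simp only [hx₀]; ring
      rw [hk]; exact hb.1 k
    · have hk : b.tgt k - x₀ k = b.tgt k - ((((a.src k).val * F.L ^ j : ℕ)) : ZMod ((F.P K).sitesPerDir 0)) + ((8 * F.L ^ j : ℕ) : ZMod ((F.P K).sitesPerDir 0)) := by
        simp only [hx₀]; ring
      rw [hk]; exact hb.2 k
  have hLipg : ∀ U U' : GaugeField (F.P K) 0 (Matrix.specialUnitaryGroup (Fin 2) ℂ), |g U - g U'| ≤
      Λ * Real.sqrt (∑ b : PBond (F.P K) 0, GaugeGroup.dist1 (U b * (U' b)⁻¹) ^ 2) :=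
    fun U U' => (hgLip U U').trans (mul_le_mul_of_nonneg_left (boxLinkDist_le_linkDist _ U U') hΛpos.le)
  -- §4 exponent identities (p-LINEAR): `cc·√β_K·(θ/4)/(17L^j·Λ) = cc·p(g_{K−j})/(68(CL+1))` by `√β_K·θ(K−j) = √(L^j)·p(g_{K−j})`
  have hKsplit : K - j + j = K := Nat.sub_add_cancel (by omega)
  have hβLj : (F.scheme ℰp γ).β K = (F.L : ℝ) ^ j * (F.scheme ℰp γ).β (K - j) := by
    show (γ * (F.P K).eps)⁻¹ = (F.L : ℝ) ^ j * (γ * (F.P (K - j)).eps)⁻¹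
    have he1 : (F.P K).eps = ((F.L : ℝ)⁻¹) ^ K := rfl
    have he2 : (F.P (K - j)).eps = ((F.L : ℝ)⁻¹) ^ (K - j) := rfl
    have hL0 : (F.L : ℝ) ≠ 0 := by positivity
    rw [he1, he2]
    conv_lhs => rw [← hKsplit]
    rw [pow_add, inv_pow, inv_pow]
    field_simp
  set p : ℝ := B10.pFun b₀ p₀ (Real.sqrt (γ * ((F.L : ℝ)⁻¹) ^ (K - j))) with hpdef
  have hβθ : (F.scheme ℰp γ).β K * θ ^ 2 = (F.L : ℝ) ^ j * p ^ 2 := by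
    rw [hβLj, mul_assoc, beta_mul_θBal_sq F hγ b₀ p₀ (K - j)]
  have hβ0 : 0 ≤ (F.scheme ℰp γ).β K := F.scheme_β_nonneg ℰp hγ.le K
  -- `p > 0` from `θ = g·p > 0`, `g > 0`
  have hgK : 0 < Real.sqrt (γ * ((F.L : ℝ)⁻¹) ^ (K - j)) :=
    Real.sqrt_pos.mpr (mul_pos hγ (pow_pos (inv_pos.mpr (by positivity)) _))
  have hp0 : 0 < p := by
    by_contra hneg
    rw [not_lt] at hneg
    have : θ ≤ 0 := by
      rw [hθ]
      show Real.sqrt (γ * ((F.L : ℝ)⁻¹) ^ (K - j)) * B10.pFun b₀ p₀ (Real.sqrt (γ * ((F.L : ℝ)⁻¹) ^ (K - j))) ≤ 0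
      exact mul_nonpos_iff.mpr (Or.inl ⟨hgK.le, hneg⟩)
    linarith
  set s : ℝ := Real.sqrt ((F.L : ℝ) ^ j) with hs
  have hs2 : s ^ 2 = (F.L : ℝ) ^ j := Real.sq_sqrt hLj.le
  have hE : Real.sqrt ((F.scheme ℰp γ).β K) * θ = s * p := by
    have h1 : Real.sqrt ((F.scheme ℰp γ).β K) * θ = Real.sqrt ((F.scheme ℰp γ).β K * θ ^ 2) := by
      rw [Real.sqrt_mul hβ0, Real.sqrt_sq hθpos.le]
    have h2 : s * p = Real.sqrt ((F.L : ℝ) ^ j * p ^ 2) := by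
      rw [Real.sqrt_mul hLj.le, Real.sqrt_sq hp0.le]
    rw [h1, h2, hβθ]
  have hN : (((17 * F.L ^ j : ℕ)) : ℝ) = 17 * s ^ 2 := by push_cast; rw [hs2]

  -- §5b THE MEDIAN CENTRING (p-linear): `Gibbs_K{g ≤ θ/8} ≥ 1/2`, then K1-exp for `−g` forces `E g ≤ θ/4`
  have hβpos : 0 < (F.scheme ℰp γ).β K := by rw [hβK]; positivity
  have hsβ : 0 < Real.sqrt ((F.scheme ℰp γ).β K) := Real.sqrt_pos.mpr hβpos
  have hnΛ : (((17 * F.L ^ j : ℕ)) : ℝ) * Λ = 17 * s * (CL + 1) := by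
    rw [hN, hΛ]
    have hs0 : s ≠ 0 := hsq.ne'
    field_simp
  have hnΛpos : 0 < (((17 * F.L ^ j : ℕ)) : ℝ) * Λ := by rw [hnΛ]; positivity
  have hhalf : 1 / 2 ≤ μ.real {U | g U ≤ θ / 8} := by
    have hcover : {U : GaugeField (F.P K) 0 (Matrix.specialUnitaryGroup (Fin 2) ℂ) | f U ≤ θ / 8} ⊆ {U | g U ≤ θ / 8} ∪ Gᶜ := by
      intro U hU
      by_cases hUG : U ∈ G
      · exact Or.inl (le_trans (hgf U hUG) hU)
      · exact Or.inr hUG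
    have h1 : μ.real {U : GaugeField (F.P K) 0 (Matrix.specialUnitaryGroup (Fin 2) ℂ) | f U ≤ θ / 8} ≤ μ.real {U | g U ≤ θ / 8} + μ.real Gᶜ :=
      (measureReal_mono hcover (measure_ne_top _ _)).trans (measureReal_union_le _ _)
    have h2 : 3 / 4 ≤ μ.real {U : GaugeField (F.P K) 0 (Matrix.specialUnitaryGroup (Fin 2) ℂ) | f U ≤ θ / 8} := hMed
    linarith
  have hint_g : ∫ U, g U ∂μ ≤ θ / 4 := by
    by_cases hr : ∫ U, g U ∂μ ≤ θ / 8
    · linarith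
    push Not at hr
    obtain ⟨r₀, hr₀⟩ : ∃ r₀ : ℝ, r₀ = ∫ U, g U ∂μ - θ / 8 := ⟨_, rfl⟩
    have hr₀pos : 0 < r₀ := by rw [hr₀]; linarith
    -- K1-exp for the admissible observable `−g` at radius `r₀`
    have hKm : μ.real {U | r₀ ≤ -g U - ∫ V, -g V ∂μ} ≤
        Cc * Real.exp (-(cc * Real.sqrt ((F.scheme ℰp γ).β K) * r₀ / ((((17 * F.L ^ j : ℕ)) : ℝ) * Λ))) :=
      hK1 (17 * F.L ^ j) h1n hnK hnβ h2n x₀ (fun U => -g U) Λ hΛpos hgmeas.neg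
        (fun u U => by show -g (GaugeField.gaugeAct u U) = -g U; rw [hginv u U])
        (fun U U' h => by show -g U = -g U'; rw [hbox U U' h])
        (fun U U' => by show |-g U - -g U'| ≤ _; rw [neg_sub_neg, abs_sub_comm]; exact hLipg U U')
        r₀ hr₀pos.le
    have hev : {U : GaugeField (F.P K) 0 (Matrix.specialUnitaryGroup (Fin 2) ℂ) | g U ≤ θ / 8} ⊆ {U | r₀ ≤ -g U - ∫ V, -g V ∂μ} := by
      intro U hU
      simp only [Set.mem_setOf_eq] at hU ⊢
      rw [integral_neg, hr₀]
      linarith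
    have hX : 1 / 2 ≤ Cc * Real.exp (-(cc * Real.sqrt ((F.scheme ℰp γ).β K) * r₀ / ((((17 * F.L ^ j : ℕ)) : ℝ) * Λ))) :=
      hhalf.trans ((measureReal_mono hev (measure_ne_top _ _)).trans hKm)
    have hA := exponent_le_log_of_half_le (div_nonneg (by positivity) hnΛpos.le) hX
    rw [div_le_iff₀ hnΛpos, hnΛ] at hA
    have hB := centring_radius_le_lin hcc hsβ hr₀pos hθpos hCL hsq hA hE hp
    rw [hr₀] at hB
    linarith
  -- §6 the event sits in the upper tail of `g`

  have hsub : ({U : GaugeField (F.P K) 0 (Matrix.specialUnitaryGroup (Fin 2) ℂ) | θ ≤ f U} ∩ G) ⊆ {U | θ / 4 ≤ g U - ∫ V, g V ∂μ} := by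
    rintro U ⟨hU1, hU2⟩
    simp only [Set.mem_setOf_eq] at hU1 ⊢
    rw [hgeq U hU2 hU1]
    linarith
  -- §7 K1-exp for `g` at `r = θ/4` and the p-linear exponent bookkeeping
  have hK := hK1 (17 * F.L ^ j) h1n hnK hnβ h2n x₀ g Λ hΛpos hgmeas hginv hbox hLipg (θ / 4) (by positivity)
  have hexp : cc * Real.sqrt ((F.scheme ℰp γ).β K) * (θ / 4) / ((((17 * F.L ^ j : ℕ)) : ℝ) * Λ) =
      cc / (68 * (CL + 1)) * p := by
    have hCL1 : (CL + 1) ≠ 0 := by linarith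
    have hs0 : s ≠ 0 := hsq.ne'
    have h1 : cc * Real.sqrt ((F.scheme ℰp γ).β K) * (θ / 4) = cc * (Real.sqrt ((F.scheme ℰp γ).β K) * θ) / 4 := by ring
    rw [h1, hE, hN, hΛ]
    field_simp
    ring
  -- §8 conclude
  calc μ.real ({U : GaugeField (F.P K) 0 (Matrix.specialUnitaryGroup (Fin 2) ℂ) | θ ≤ f U} ∩ G)
      ≤ μ.real {U | θ / 4 ≤ g U - ∫ V, g V ∂μ} := measureReal_mono hsub (measure_ne_top _ _)
    _ ≤ Cc * Real.exp (-(cc * Real.sqrt ((F.scheme ℰp γ).β K) * (θ / 4) / ((((17 * F.L ^ j : ℕ)) : ℝ) * Λ))) := hK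
    _ = Cc * Real.exp (-(cc / (68 * (CL + 1)) * p)) := by rw [hexp]

end Summit.QuantumFields.YangMills.Theorems.PoincareLipschitzMedianCentringLinearStepUV
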